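import Summits.QuantumFields.YangMills.Theses.HyperbolicRegulator

/-!
# Route `HyperbolicRegulator`, crux `CurvatureAnchorR` (stmt-QuantumFields-18155): vocabulary of the line `witten_hessian`

Route-posited objects (D-0016 `<Route><Crux>Defs` file) shared by the registered skeleton
`Cruxes/CurvatureAnchorR/Lines/witten_hessian.lean` (lead `prover-line-stmt-QuantumFields-18155-0`, skeleton sha `c8040c64…`)
and by the stub files that prove its registered stubs (`stub_towers`, `stub_kunneth`, `stub_ct`, `stub_mixing`,
`stub_instantiate`).  NOTHING here is asserted about the route: the file contains the eight `G`-free definitions of the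
skeleton, BYTE FOR BYTE (so that every stub file and the final composition elaborate against one copy), and one-line
destructuring lemmas of `AdmR` (definitional unfolding only).

* `AdmR` — verbatim the first component `(Fam k j …).1` of the crux
  `Summit.QuantumFields.YangMills.Theses.HyperbolicRegulator.CurvatureAnchorR` (admissibility of one finite square complex:
  graph/square axioms, degrees 4 or 5, every edge in two squares, cones `k`-dense and `k`-separated, Poincaré `10⁶k²`, two
  deep points at distance `≥ j`, injective `ℤ²`-charts of sup-radius `k/4` at flat points).
* `Tame`, `Coh`, `DualPoinc`, `SqCx`, `Poinc` — the `G`-free combinatorial / spectral predicates of the line.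
* `KunnethGap` — the Künneth–Poincaré gap of the 1-form Hodge Laplacian of the product complex `S × S` (conclusion of
  `stub_kunneth`).
* `CombesThomasSqrt` — the finite-matrix Combes–Thomas lemma with the square-root rate (statement of `stub_ct`).

References: the route file `Theses/HyperbolicRegulator.lean` for the crux; `Cruxes/CurvatureAnchorR/PICKED.md`,
`Lines/witten_hessian.md` and `STRATEGY-CENSUS.md` for the line.  The combinatorics is folklore (square complexes, cochains);
no published theorem is restated here (the Combes–Thomas estimate is stated as a `Prop` to be PROVED by `stub_ct`, not cited).
-/

set_option autoImplicit false

noncomputable section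

namespace Summit.QuantumFields.YangMills.Cruxes.CurvatureAnchorR.WittenHessian

open scoped BigOperators Topology Manifold Classical MeasureTheory ProbabilityTheory Matrix InnerProductSpace ComplexConjugate ContinuousMap
open Filter Set Function TopologicalSpace MeasureTheory
open Literature.MathematicalPhysics.QuantumFieldTheory Literature.MathematicalPhysics.QuantumLattice
open Summit.QuantumFields.YangMills.Theses.HyperbolicRegulator

/-- ADMISSIBILITY of one finite square complex at curvature scale `k` and separation index `j` —
VERBATIM the first component `(Fam k j V E Q σ τ bd cV cE).1` of the REPAIRED crux `CurvatureAnchorR`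
(flat `k / 2 < dist`, deep `3 * (k / 4) < dist`, chart box `(k:ℤ)/4`; byte-identical to the disprover's
`Cruxes.CurvatureAnchor.Disproof.AdmR`; `G`-free). -/
def AdmR (k j : ℕ) (V E Q : Finset ℕ) (σ τ : ℕ → ℕ) (bd : ℕ → Fin 4 → ℕ × Bool) (cV : ℕ → ℤ × ℤ → ℕ)
    (cE : ℕ → ℤ × ℤ → Fin 2 → ℕ × Bool) : Prop :=
  let st := fun e : ℕ × Bool => if e.2 then σ e.1 else τ e.1; let en := fun e : ℕ × Bool => if e.2 then τ e.1 else σ e.1; let Γ := SimpleGraph.fromRel fun a b : ℕ => ∃ e ∈ E, σ e = a ∧ τ e = b; let dg := fun x : ℕ => (E.filter fun e => σ e = x ∨ τ e = x).card; let K := V.filter fun x => dg x = 5; let F := fun x : ℕ => x ∈ V ∧ ∀ c ∈ K, k / 2 < Γ.dist x c; let Dp := fun x : ℕ => x ∈ V ∧ ∀ c ∈ K, 3 * (k / 4) < Γ.dist x c; let ib := fun a : ℤ × ℤ => |a.1| ≤ (k : ℤ) / 4 ∧ |a.2| ≤ (k : ℤ) / 4; let nx := fun (a : ℤ × ℤ)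 (μ : Fin 2) => if μ = 0 then (a.1 + 1, a.2) else (a.1, a.2 + 1); (∀ e ∈ E, σ e ∈ V ∧ τ e ∈ V ∧ σ e ≠ τ e) ∧ (∀ q ∈ Q, (∀ i, (bd q i).1 ∈ E) ∧ (∀ i, en (bd q i) = st (bd q (i + 1))) ∧ (st ∘ bd q).Injective) ∧ (∀ e ∈ E, (Q.filter fun q => ∃ i, (bd q i).1 = e).card = 2) ∧ (∀ x ∈ V, (dg x = 4 ∨ dg x = 5) ∧ (Q.filter fun q => ∃ i, st (bd q i) = x).card = dg x) ∧ (∀ x ∈ V, ∃ c ∈ K, Γ.dist x c ≤ k) ∧ (∀ c ∈ K, ∀ c' ∈ K, c ≠ c' → k ≤ Γ.dist c c') ∧ (∀ f : ℕ → ℝ, ∑ x ∈ V, f x = 0 → ∑ x ∈ V, f x ^ 2 ≤ 10 ^ 6 * (k : ℝ) ^ 2 * ∑ e ∈ E, (f (σ e) - f (τ e)) ^ 2) ∧ (∃ x y, Dp x ∧ Dp y ∧ j ≤ Γ.dist x y) ∧ (∀ x, F x → cV x (0, 0) = x ∧ (∀ a, ib a → cV x a ∈ V) ∧ Set.InjOn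 (cV x) {a | ib a} ∧ (∀ a μ, ib a → ib (nx a μ) → (cE x a μ).1 ∈ E ∧ st (cE x a μ) = cV x a ∧ en (cE x a μ) = cV x (nx a μ)) ∧ (∀ a, ib a → ib (a.1 + 1, a.2 + 1) → ∃ q ∈ Q, Finset.univ.image (Prod.fst ∘ bd q) = {(cE x a 0).1, (cE x (nx a 0) 1).1, (cE x (nx a 1) 0).1, (cE x a 1).1}))

/-- TAMENESS at scale `L` (the topology handed across the seam; `G`-free). (i) NO PINCHES: two
distinct squares share at most one edge, so every vertex link is a cycle (`C₄` or `C₅`) and the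
complex is a closed non-positively curved square surface; (ii) BALLS OF RADIUS `L` ARE `ℤ/2`-ACYCLIC IN
DEGREE ONE: for every vertex `x`, on the full subcomplex spanned by the vertices within graph distance
`L` of `x` (its edges `EB`, its squares `QB`), every `ℤ/2` 1-cocycle `Z ⊆ EB` (each square of `QB`
contains an even number of `Z`-edges) is a coboundary (`Z = δW`: the edges with exactly one endpoint
in `W`). For a surface complex a proper connected subcomplex has free `π₁`, so (ii) says every
`L`-ball is simply connected: combinatorial injectivity radius `≳ L`, no essential loop shorter than
`≈ 2L` — separating or not. -/
def Tame (L : ℕ) (V E Q : Finset ℕ) (σ τ : ℕ → ℕ) (bd : ℕ → Fin 4 → ℕ × Bool) : Prop :=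
  let st := fun e : ℕ × Bool => if e.2 then σ e.1 else τ e.1
  let Γ := SimpleGraph.fromRel fun a b : ℕ => ∃ e ∈ E, σ e = a ∧ τ e = b
  (∀ q ∈ Q, ∀ q' ∈ Q, q ≠ q' →
      (Finset.univ.image (Prod.fst ∘ bd q) ∩ Finset.univ.image (Prod.fst ∘ bd q')).card ≤ 1) ∧
  ∀ x ∈ V,
    let B := V.filter fun y => ∃ p : Γ.Walk x y, p.length ≤ L
    let EB := E.filter fun e => σ e ∈ B ∧ τ e ∈ B
    let QB := Q.filter fun q => ∀ i, st (bd q i) ∈ B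
    ∀ Z ⊆ EB, (∀ q ∈ QB, Even ((Finset.univ.filter fun i : Fin 4 => (bd q i).1 ∈ Z).card)) →
      ∃ W ⊆ B, ∀ e ∈ EB, (e ∈ Z ↔ Xor (σ e ∈ W) (τ e ∈ W))


/-- COHERENT ORIENTATION of the squares (`G`-free): whenever two distinct squares contain the same
edge they traverse it with opposite direction flags — an orientation of the closed square surface
(the intended covers of Bring's / the `(2,4,5)` surface are orientable).  With `AdmR` (every edge in
exactly two squares) this makes `ker d₁* =` constants, so the dual Poincaré inequality below is the
honest dual-graph spectral gap. -/
def Coh (Q : Finset ℕ) (bd : ℕ → Fin 4 → ℕ × Bool) : Prop :=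
  ∀ q ∈ Q, ∀ q' ∈ Q, q ≠ q' → ∀ i i' : Fin 4, (bd q i).1 = (bd q' i').1 → (bd q i).2 ≠ (bd q' i').2

/-- DUAL POINCARÉ INEQUALITY at scale `k` (`G`-free): for every real function `g` on the squares
with `∑_Q g = 0`, `∑_Q g² ≤ 10⁶ k² · ∑_{e ∈ E} (∑_{q ∋ e} ± g q)²`, the sign being the direction
flag with which `q` traverses `e` (so with `Coh` the inner sum is `±(g q₁ − g q₂)` over the two
squares at `e`: the Dirichlet form of the DUAL graph).  Same constant as the primal clause 7 of
`AdmR`; for the intended family the dual graph is again a `k`-subdivided-type hyperbolic surface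
graph with gap `≍ 1/k²`. -/
def DualPoinc (k : ℕ) (E Q : Finset ℕ) (bd : ℕ → Fin 4 → ℕ × Bool) : Prop :=
  ∀ g : ℕ → ℝ, ∑ q ∈ Q, g q = 0 →
    ∑ q ∈ Q, g q ^ 2 ≤ 10 ^ 6 * (k : ℝ) ^ 2 *
      ∑ e ∈ E, (∑ q ∈ Q, ∑ i : Fin 4, if (bd q i).1 = e then (if (bd q i).2 then g q else -g q) else 0) ^ 2

/-- SQUARE-COMPLEX WELL-FORMEDNESS (`G`-free) — VERBATIM clauses 1–3 of `AdmR` with its `st/en`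
vocabulary: edges have distinct endpoints in `V`; every square boundary is a closed 4-edge word in
`E` through 4 distinct vertices; every edge lies in exactly two squares.  (All that `stub_kunneth`
needs of admissibility besides the Poincaré clause; unaffected by the R3 repair.) -/
def SqCx (V E Q : Finset ℕ) (σ τ : ℕ → ℕ) (bd : ℕ → Fin 4 → ℕ × Bool) : Prop :=
  let st := fun e : ℕ × Bool => if e.2 then σ e.1 else τ e.1
  let en := fun e : ℕ × Bool => if e.2 then τ e.1 else σ e.1
  (∀ e ∈ E, σ e ∈ V ∧ τ e ∈ V ∧ σ e ≠ τ e) ∧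
    (∀ q ∈ Q, (∀ i, (bd q i).1 ∈ E) ∧ (∀ i, en (bd q i) = st (bd q (i + 1))) ∧ (st ∘ bd q).Injective) ∧
      (∀ e ∈ E, (Q.filter fun q => ∃ i, (bd q i).1 = e).card = 2)

/-- PRIMAL POINCARÉ INEQUALITY at scale `k` (`G`-free) — VERBATIM clause 7 of `AdmR`:
`∑_V f² ≤ 10⁶ k² ∑_E (f(σe) − f(τe))²` for every `f` with `∑_V f = 0` (graph spectral gap
`≥ 10⁻⁶/k²`; it also forces connectedness). -/
def Poinc (k : ℕ) (V E : Finset ℕ) (σ τ : ℕ → ℕ) : Prop :=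
  ∀ f : ℕ → ℝ, ∑ x ∈ V, f x = 0 → ∑ x ∈ V, f x ^ 2 ≤ 10 ^ 6 * (k : ℝ) ^ 2 * ∑ e ∈ E, (f (σ e) - f (τ e)) ^ 2

/-- **The Künneth–Poincaré gap of the product complex** (conclusion of `stub_kunneth`, hypothesis
of `stub_gjs`; `G`-free).  Real 1-cochains `ω` on the product edge set
`PE = (E × V) ⊔ (V × E)` of `X = S × S` (values off `PE` are never read), the product coboundary
`d₁` on the three plaquette sorts — square×vertex `(q, y)`, vertex×square `(y, q)` and edge×edge
`(e, e')`, the last with EXACTLY the boundary word of the action's edge×edge plaquette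
`[(inl (e, σ e'), +), (inr (τ e, e'), +), (inl (e, τ e'), −), (inr (σ e, e'), −)]` — and the
divergence `d₀*` at product vertices `(x, y) ∈ V × V` (plain `ℓ²` adjoint of the product gradient).
`Harm h`: `d₁ h = 0` on all three sorts and `d₀* h = 0`.  The statement: every `ω` is within
`10⁷ k² · (‖d₀* ω‖² + ‖d₁ ω‖²)` (in `ℓ²(PE)`) of a harmonic `h` — i.e. the Hodge Laplacian
`Δ₁ = d₀d₀* + d₁*d₁` of `X` has spectral gap `≥ 10⁻⁷/k²` on the orthocomplement of the harmonic
(toron) 1-cochains.  Mechanism (Künneth): `C¹(X) = C¹(S)⊗C⁰(S) ⊕ C⁰(S)⊗C¹(S)` with the Koszul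
sign, `Δ₁^X = Δ^S ⊗ 1 + 1 ⊗ Δ^S`, so the non-zero spectrum is bounded below by
`min(λ₁(Δ₀^S), λ₁(Δ₂^S)) ≥ 10⁻⁶/k²` (primal Poincaré = clause 7 of `AdmR`, dual Poincaré =
`DualPoinc` with coherent orientations `Coh`): a factorwise-harmonic form tensored with a
NON-constant function still pays the other factor's Poincaré constant — the reason the product of
TWO hyperbolic factors is forced (S × ℤ² is gapless).  The cochain formulas below were checked
against this Kronecker-sum identity by exact integer arithmetic on torus grids
(`compute/kunneth_check.py`, n = 3, 4: `d₁∘d₀ = 0`, `div = d₀ᵀ`, `Δ₁^X = Künneth sum` all `True`). -/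
def KunnethGap (k : ℕ) (V E Q : Finset ℕ) (σ τ : ℕ → ℕ) (bd : ℕ → Fin 4 → ℕ × Bool) : Prop :=
  let sg := fun b : ℕ × Bool => (if b.2 then (1 : ℝ) else -1)
  let dA := fun (ω : ((ℕ × ℕ) ⊕ (ℕ × ℕ) → ℝ)) (q y : ℕ) => ∑ i : Fin 4, sg (bd q i) * ω (Sum.inl ((bd q i).1, y))
  let dB := fun (ω : ((ℕ × ℕ) ⊕ (ℕ × ℕ) → ℝ)) (y q : ℕ) => ∑ i : Fin 4, sg (bd q i) * ω (Sum.inr (y, (bd q i).1))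
  let dC := fun (ω : ((ℕ × ℕ) ⊕ (ℕ × ℕ) → ℝ)) (e e' : ℕ) =>
    ω (Sum.inl (e, σ e')) + ω (Sum.inr (τ e, e')) - ω (Sum.inl (e, τ e')) - ω (Sum.inr (σ e, e'))
  let dv := fun (ω : ((ℕ × ℕ) ⊕ (ℕ × ℕ) → ℝ)) (x y : ℕ) =>
    (∑ e ∈ E.filter (fun e => τ e = x), ω (Sum.inl (e, y))) - (∑ e ∈ E.filter (fun e => σ e = x), ω (Sum.inl (e, y))) +
      ((∑ e ∈ E.filter (fun e => τ e = y), ω (Sum.inr (x, e))) - ∑ e ∈ E.filter (fun e => σ e = y), ω (Sum.inr (x, e)))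
  let Harm := fun (h : ((ℕ × ℕ) ⊕ (ℕ × ℕ) → ℝ)) =>
    (∀ q ∈ Q, ∀ y ∈ V, dA h q y = 0) ∧ (∀ y ∈ V, ∀ q ∈ Q, dB h y q = 0) ∧
      (∀ e ∈ E, ∀ e' ∈ E, dC h e e' = 0) ∧ (∀ x ∈ V, ∀ y ∈ V, dv h x y = 0)
  let Nm := fun (ω : ((ℕ × ℕ) ⊕ (ℕ × ℕ) → ℝ)) => (∑ e ∈ E, ∑ y ∈ V, ω (Sum.inl (e, y)) ^ 2) + ∑ y ∈ V, ∑ e ∈ E, ω (Sum.inr (y, e)) ^ 2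
  let Dir := fun (ω : ((ℕ × ℕ) ⊕ (ℕ × ℕ) → ℝ)) =>
    (∑ x ∈ V, ∑ y ∈ V, dv ω x y ^ 2) + (∑ q ∈ Q, ∑ y ∈ V, dA ω q y ^ 2) +
      (∑ y ∈ V, ∑ q ∈ Q, dB ω y q ^ 2) + ∑ e ∈ E, ∑ e' ∈ E, dC ω e e' ^ 2
  ∀ ω : (ℕ × ℕ) ⊕ (ℕ × ℕ) → ℝ, ∃ h : (ℕ × ℕ) ⊕ (ℕ × ℕ) → ℝ,
    Harm h ∧ Nm (fun z => ω z - h z) ≤ 10 ^ 7 * (k : ℝ) ^ 2 * Dir ω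

/-- **The Combes–Thomas lemma with the square-root rate** (the line's ENGINE, finite-dimensional template; `G`-free,
TRUE, M-sized).  A real symmetric matrix `H` on a finite metric index set with `H ≥ m² > 0` as a form, hopping of range
`1` (`H x y = 0` if `d x y > 1`) and absolute off-diagonal row sums `≤ τ` has an inverse whose entries decay like
`(2/m²)·exp(−μ·d x y)` for every `μ ≥ 0` with `(cosh μ − 1)·τ ≤ m²/2`, i.e. at rate `μ ≍ m/√τ = √(gap/hopping)` — NOT the
naive `gap/hopping`.  Proof (three lines on paper): conjugate by `E = diag(e^{μ d(x₀,·)})`; `E H E⁻¹ − H` splits into a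
SYMMETRIC part `(cosh(μ(ρ_x − ρ_y)) − 1)·H x y` of operator norm `≤ (cosh μ − 1)τ ≤ m²/2` (Schur test) and an ANTISYMMETRIC
part `sinh(μ(ρ_x − ρ_y))·H x y`, which drops out of `⟨u, E H E⁻¹ u⟩`; so `w := (E H E⁻¹)⁻¹ e_{x₀}` has
`(m²/2)|w|² ≤ ⟨w, E H E⁻¹ w⟩ = w x₀ ≤ |w|`, whence `|w| ≤ 2/m²` and `|H⁻¹ y x₀| = e^{−μ d x₀ y}|w y| ≤ (2/m²)e^{−μ d}`.  This is
why an L²-GAP ALONE (here `10⁻⁷/k²`, hopping `O(1)`) yields the anchor's rate `≍ 1/k` with no ℓ¹-summability of anything —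
the property the whole line is built on (module docstring §2).  Leans on: Mathlib `Matrix.PosSemidef`, `Matrix.inv`,
`Real.cosh`. -/
def CombesThomasSqrt : Prop :=
  ∀ (ι : Type) [Fintype ι] [DecidableEq ι] (d : ι → ι → ℕ) (H : Matrix ι ι ℝ) (m τ μ : ℝ),
    (∀ x, d x x = 0) → (∀ x y, d x y = d y x) → (∀ x y z, d x z ≤ d x y + d y z) →
    H.IsSymm → (H - m ^ 2 • (1 : Matrix ι ι ℝ)).PosSemidef → 0 < m →
    (∀ x y, 1 < d x y → H x y = 0) → (∀ x, ∑ y ∈ Finset.univ.erase x, |H x y| ≤ τ) →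
    0 ≤ μ → (Real.cosh μ - 1) * τ ≤ m ^ 2 / 2 →
    ∀ x y, |H⁻¹ x y| ≤ 2 / m ^ 2 * Real.exp (-(μ * d x y))

/-! ## Destructuring lemmas of `AdmR` (definitional unfolding only) -/

section Destructuring

variable {k j : ℕ} {V E Q : Finset ℕ} {σ τ : ℕ → ℕ} {bd : ℕ → Fin 4 → ℕ × Bool} {cV : ℕ → ℤ × ℤ → ℕ}
  {cE : ℕ → ℤ × ℤ → Fin 2 → ℕ × Bool}

/-- Clauses 1–3 of `AdmR` are the square-complex well-formedness `SqCx`. -/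
theorem AdmR.sqCx (hA : AdmR k j V E Q σ τ bd cV cE) : SqCx V E Q σ τ bd :=
  ⟨hA.1, hA.2.1, hA.2.2.1⟩

/-- Clause 7 of `AdmR` is the primal Poincaré inequality `Poinc k`. -/
theorem AdmR.poinc (hA : AdmR k j V E Q σ τ bd cV cE) : Poinc k V E σ τ :=
  hA.2.2.2.2.2.2.1

/-- Clause 1 of `AdmR`: edges have distinct endpoints in `V`. -/
theorem AdmR.edges (hA : AdmR k j V E Q σ τ bd cV cE) : ∀ e ∈ E, σ e ∈ V ∧ τ e ∈ V ∧ σ e ≠ τ e :=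
  hA.1

/-- Clause 3 of `AdmR`: every edge lies in exactly two squares. -/
theorem AdmR.two_squares (hA : AdmR k j V E Q σ τ bd cV cE) :
    ∀ e ∈ E, (Q.filter fun q => ∃ i, (bd q i).1 = e).card = 2 :=
  hA.2.2.1

end Destructuring

end Summit.QuantumFields.YangMills.Cruxes.CurvatureAnchorR.WittenHessian

end
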